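import Summits.HodgeConjecture.HodgeConjecture.Theorems.MarkmanPartnerTransportPartnerExistenceLatticeTransc
import Literature.AlgebraicGeometry.Surfaces.K3LatticeInvariantsProofs

/-!
# Route MarkmanPartnerTransport · support #3 `IsometrySpannedThird` — partner-free preliminaries on a marked
# `K3^{[2]}`-type fourfold: top-degree classes, off-type vanishing, and the period line as a double orthogonal

First bricks of the PARTNER-FREE treatment of the `E = ℚ` third at every Picard rank (blueprint in the
session notes of prover seat hodge-nonav-19652-p1 gen 6: a rational `(2,2)`-class `c ∈ H⁴(X)` defines, via
`(c ∪ y ∪ w) = q(F_c y, w)·P`, a rational Hodge `q`-self-adjoint endomorphism `F_c` of `H²(X)`; on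
`H² = N¹ ⊕ T` it is block-diagonal, a rational scalar on `T` by the `E = ℚ` clause, and such endomorphisms
are exactly those of the algebraic classes `Σ sₖₗ dₖdₗ + t·q^∨`):

* `generator_ne_zero_of_markedSq`, `exists_smul_generator_top` — `P ≠ 0` and `H⁸(X) = ℂ·P`;
* `exists_rat_smul_generator_of_isRationalClass` — a rational class of `H⁸` is a RATIONAL multiple of `P`;
* `eq_zero_of_isOfHodgeType_top_of_fst_ne_four` — a class of `H⁸` of type `(p,q)`, `p + q = 8`, `p ≠ 4`,
  vanishes;
* `exists_smul_period_of_orthogonal` — a class `q`-orthogonal to the period and to every `(1,1)`-class is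
  a multiple of the period class `φ⁻¹ z` (`q` is non-degenerate on `⟨z, z̄⟩` and on its orthogonal `H^{1,1}`).

No definition, no sorry, no named fact. Prover seat hodge-nonav-19652-p1 (gen 6),
`--supports stmt-HodgeConjecture-19651`.

References: C. Voisin, *Hodge Theory I* §6.1, §7.1; A. Beauville, J. Differential Geom. 18 (1983) §8–9;
K. O'Grady, *Mat. Contemp.* (2008) §2–3.
-/

noncomputable section

set_option linter.dupNamespace false

open scoped Matrix
open Module CategoryTheory
open Literature.AlgebraicTopology.SingularHomology Literature.Geometry.Kaehler
open Literature.AlgebraicGeometry Literature.AlgebraicGeometry.Motives Literature.AlgebraicGeometry.HodgeTheory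
open Literature.AlgebraicGeometry.Hyperkaehler Literature.AlgebraicGeometry.Surfaces
open Summit.HodgeConjecture.HodgeConjecture.Theorems.NikulinTwinTransport
open Summit.HodgeConjecture.HodgeConjecture.Theorems.MarkmanPartnerTransport.BBFPositivity

namespace Summit.HodgeConjecture.HodgeConjecture.Theorems.MarkmanPartnerTransport.PartnerLattice

/-- `MarkedK3Sq[X, φ, P, z]`: VERBATIM the `let MarkedK3Sq := …` binder of the route declarations of
MarkmanPartnerTransport (clauses (m1)–(m6)). Local notation only. -/
local notation3 (prettyPrint := false) "MarkedK3Sq[" X ", " φ ", " P ", " z "]" =>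
  (((IsIntegralClass P ∧ ∀ Q : complexBetti X (2 * 4), IsIntegralClass Q → ∃ n : ℤ, Q = n • P) ∧
    (∀ c : complexBetti X 2, IsIntegralClass c ↔ ∃ v : K3HilbertIndex → ℤ, φ c = fun i => (v i : ℂ)) ∧
    (∀ a : complexBetti X 2, cupPowTwo a 4 = ((3 : ℂ) * (k3HilbertForm 2 (φ a) (φ a)) ^ 2) • P) ∧
    (IsOfHodgeType 4 X 2 2 0 (LinearEquiv.symm φ z) ∧
      ∀ τ : complexBetti X 2, IsOfHodgeType 4 X 2 2 0 τ → ∃ t : ℂ, τ = t • LinearEquiv.symm φ z) ∧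
    (∀ c : complexBetti X 2, IsOfHodgeType 4 X 2 1 1 c ↔
      (k3HilbertForm 2 (φ c) z = 0 ∧ k3HilbertForm 2 (φ c) (star z) = 0)) ∧
    (k3HilbertForm 2 z z = 0 ∧ 0 < (k3HilbertForm 2 (star z) z).re)))

variable {X : SchemeOver ℂ} {φ : complexBetti X 2 ≃ₗ[ℂ] (K3HilbertIndex → ℂ)} {P : complexBetti X (2 * 4)}
  {z : K3HilbertIndex → ℂ}

/-! ### Top degree -/

/-- **The marking generator `P` of `H⁸(X)` is non-zero** (its trace against a Kähler–rational datum is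
positive, `cTrace_pos_and_kaehler_pos`). [cite: Beauville1983, §8 Thm. 5] -/
theorem generator_ne_zero_of_markedSq (hX : IsSmoothProjective 4 X) (hM : MarkedK3Sq[X, φ, P, z]) : P ≠ 0 := by
  obtain ⟨D⟩ := nonempty_kaehlerRationalDatum hX
  have h := (cTrace_pos_and_kaehler_pos hX hM D).1.1
  rintro rfl
  rw [map_zero, Complex.zero_re] at h
  exact lt_irrefl _ h

/-- **`H⁸(X) = ℂ·P`**: every top-degree class is a multiple of the marking generator (`b₈ = 1`).
[cite: HatcherAT2002, §3.3 Cor. 3.37] -/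
theorem exists_smul_generator_top (hX : IsSmoothProjective 4 X) (hM : MarkedK3Sq[X, φ, P, z])
    (x : complexBetti X (2 * 4)) : ∃ t : ℂ, x = t • P := by
  have h1 : Module.finrank ℂ (complexBetti X (2 * 4)) = 1 := finrank_complexBetti_top hX
  haveI : FiniteDimensional ℂ (complexBetti X (2 * 4)) := Module.finite_of_finrank_eq_succ h1
  have hP := generator_ne_zero_of_markedSq hX hM
  obtain ⟨t, ht⟩ := (finrank_eq_one_iff_of_nonzero' P hP).1 h1 x
  exact ⟨t, ht.symm⟩

/-- **A RATIONAL top-degree class is a rational multiple of `P`** (an integral multiple of it is integral,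
hence an integral multiple of the integral generator (m1)). [cite: VoisinHodgeI2002, §7.1.1] -/
theorem exists_rat_smul_generator_of_isRationalClass (hX : IsSmoothProjective 4 X) (hM : MarkedK3Sq[X, φ, P, z])
    {x : complexBetti X (2 * 4)} (hx : IsRationalClass x) : ∃ r : ℚ, x = (r : ℂ) • P := by
  obtain ⟨⟨-, hgen⟩, -⟩ := id hM
  obtain ⟨N, hN, hNx⟩ := hx.exists_nsmul_isIntegralClass hX
  obtain ⟨n, hn⟩ := hgen _ hNx
  refine ⟨(n : ℚ) / N, ?_⟩
  have hN0 : (N : ℂ) ≠ 0 := by exact_mod_cast hN.ne'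
  have hx' : x = (N : ℂ)⁻¹ • ((N : ℂ) • x) := by rw [smul_smul, inv_mul_cancel₀ hN0, one_smul]
  rw [hx', hn, ← Int.cast_smul_eq_zsmul ℂ n P, smul_smul]
  congr 1
  push_cast
  rw [div_eq_inv_mul]

/-- **A top-degree class of Hodge type `(p, q)` with `p ≠ 4` vanishes** (`H⁸ = H^{4,4}`: for `p > 4` the
piece is zero, for `p < 4` conjugate). [cite: VoisinHodgeI2002, §6.1.3 Cor. 6.12 and §7.1.1] -/
theorem eq_zero_of_isOfHodgeType_top_of_fst_ne_four (hX : IsSmoothProjective 4 X) {p q : ℕ}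
    (hpq : p + q = 2 * 4) (hp : p ≠ 4) {x : complexBetti X (2 * 4)} (hx : IsOfHodgeType 4 X (2 * 4) p q x) :
    x = 0 := by
  rcases lt_or_gt_of_ne hp with hlt | hgt
  · -- `q > 4`: conjugate
    have hq : 4 < q := by omega
    have hconj := hx.conjClass hX
    have h0 : conjClass (ComplexPoints X) (2 * 4) x = 0 :=
      eq_zero_of_isOfHodgeType_of_four_lt hX (by omega) hq hconj
    rw [← conjClass_conjClass x, h0, conjClass_zero]
  · exact eq_zero_of_isOfHodgeType_of_four_lt hX hpq hgt hx

/-! ### The period line as a double orthogonal -/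

/-- **A class `q`-orthogonal to the period `z` and to all `(1,1)`-classes is a multiple of the period
class `φ⁻¹ z`.**  In the marking: `ℂ²³ ∋ u = a z + b z̄ + h` with `h ⟂ z, z̄` (as `q(z, z̄) ≠ 0`,
`q(z,z) = q(z̄,z̄) = 0`); `h` is `(1,1)` and orthogonal to every `(1,1)`-vector and to `z, z̄`, hence in the
radical of `q`, i.e. `0`; and `u ⟂ z` forces `b = 0`. [cite: Beauville1983, §8 Thm. 5 and §9]
[cite: VoisinHodgeI2002, §6.1.2] -/
theorem exists_smul_period_of_orthogonal (hM : MarkedK3Sq[X, φ, P, z])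
    {v : complexBetti X 2} (hvz : k3HilbertForm 2 (φ v) z = 0)
    (hv11 : ∀ h : complexBetti X 2, IsOfHodgeType 4 X 2 1 1 h → k3HilbertForm 2 (φ v) (φ h) = 0) :
    ∃ t : ℂ, v = t • φ.symm z := by
  obtain ⟨-, -, -, -, h11, ⟨hzz, hzpos⟩⟩ := id hM
  -- `q(z, z̄) ≠ 0`, `q(z̄, z̄) = 0`
  have hzzbar : k3HilbertForm 2 z (star z) ≠ 0 := by
    intro h0
    rw [k3HilbertForm_comm] at h0
    rw [h0, Complex.zero_re] at hzpos
    exact lt_irrefl _ hzpos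
  have hzbarzbar : k3HilbertForm 2 (star z) (star z) = 0 := by
    have h := congrArg star hzz
    rwa [star_k3HilbertForm, star_zero] at h
  set u := φ v with hu
  -- the `(1,1)`-part of `u`
  set a : ℂ := k3HilbertForm 2 u (star z) / k3HilbertForm 2 z (star z) with ha
  set b : ℂ := k3HilbertForm 2 u z / k3HilbertForm 2 (star z) z with hb
  have hb0 : b = 0 := by rw [hb, hvz, zero_div]
  set h : K3HilbertIndex → ℂ := u - a • z - b • star z with hh
  have hhz : k3HilbertForm 2 h z = 0 := by
    rw [hh, sub_eq_add_neg, sub_eq_add_neg, k3HilbertForm_add_left, k3HilbertForm_add_left, ← neg_one_smul ℂ (a • z),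
      ← neg_one_smul ℂ (b • star z), k3HilbertForm_smul_left, k3HilbertForm_smul_left,
      k3HilbertForm_smul_left, k3HilbertForm_smul_left, hzz, hb]
    have hne : k3HilbertForm 2 (star z) z ≠ 0 := by rwa [k3HilbertForm_comm] at hzzbar
    field_simp
    ring
  have hhzbar : k3HilbertForm 2 h (star z) = 0 := by
    rw [hh, sub_eq_add_neg, sub_eq_add_neg, k3HilbertForm_add_left, k3HilbertForm_add_left, ← neg_one_smul ℂ (a • z),
      ← neg_one_smul ℂ (b • star z), k3HilbertForm_smul_left, k3HilbertForm_smul_left,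
      k3HilbertForm_smul_left, k3HilbertForm_smul_left, hzbarzbar, ha]
    field_simp
    ring
  -- `h` is a `(1,1)`-vector orthogonal to all `(1,1)`-vectors and to `z, z̄`: it is in the radical of `q`
  have hh11 : IsOfHodgeType 4 X 2 1 1 (φ.symm h) :=
    (h11 _).2 ⟨by rw [LinearEquiv.apply_symm_apply]; exact hhz, by rw [LinearEquiv.apply_symm_apply]; exact hhzbar⟩
  have huh : ∀ w : K3HilbertIndex → ℂ, IsOfHodgeType 4 X 2 1 1 (φ.symm w) → k3HilbertForm 2 u w = 0 := by
    intro w hw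
    have := hv11 _ hw
    rwa [LinearEquiv.apply_symm_apply] at this
  have hrad : ∀ w : K3HilbertIndex → ℂ, k3HilbertForm 2 h w = 0 := by
    intro w
    -- decompose `w = a' z + b' z̄ + h'` with `h'` of type `(1,1)`
    set a' : ℂ := k3HilbertForm 2 w (star z) / k3HilbertForm 2 z (star z) with ha'
    set b' : ℂ := k3HilbertForm 2 w z / k3HilbertForm 2 (star z) z with hb'
    set h' : K3HilbertIndex → ℂ := w - a' • z - b' • star z with hh'
    have hne : k3HilbertForm 2 (star z) z ≠ 0 := by rwa [k3HilbertForm_comm] at hzzbar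
    have hh'z : k3HilbertForm 2 h' z = 0 := by
      rw [hh', sub_eq_add_neg, sub_eq_add_neg, k3HilbertForm_add_left, k3HilbertForm_add_left,
        ← neg_one_smul ℂ (a' • z), ← neg_one_smul ℂ (b' • star z), k3HilbertForm_smul_left,
        k3HilbertForm_smul_left, k3HilbertForm_smul_left, k3HilbertForm_smul_left, hzz, hb']
      field_simp
      ring
    have hh'zbar : k3HilbertForm 2 h' (star z) = 0 := by
      rw [hh', sub_eq_add_neg, sub_eq_add_neg, k3HilbertForm_add_left, k3HilbertForm_add_left,
        ← neg_one_smul ℂ (a' • z), ← neg_one_smul ℂ (b' • star z), k3HilbertForm_smul_left,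
        k3HilbertForm_smul_left, k3HilbertForm_smul_left, k3HilbertForm_smul_left, hzbarzbar, ha']
      field_simp
      ring
    have hh'11 : IsOfHodgeType 4 X 2 1 1 (φ.symm h') :=
      (h11 _).2 ⟨by rw [LinearEquiv.apply_symm_apply]; exact hh'z,
        by rw [LinearEquiv.apply_symm_apply]; exact hh'zbar⟩
    -- `q(h, h') = q(u, h') - a q(z, h') - b q(z̄, h') = 0`
    have hhh' : k3HilbertForm 2 h h' = 0 := by
      rw [hh, sub_eq_add_neg, sub_eq_add_neg, k3HilbertForm_add_left, k3HilbertForm_add_left,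
        ← neg_one_smul ℂ (a • z), ← neg_one_smul ℂ (b • star z), k3HilbertForm_smul_left,
        k3HilbertForm_smul_left, k3HilbertForm_smul_left, k3HilbertForm_smul_left, huh h' hh'11,
        k3HilbertForm_comm 2 z h', hh'z, k3HilbertForm_comm 2 (star z) h', hh'zbar]
      ring
    have hw : w = h' + a' • z + b' • star z := by rw [hh']; abel
    rw [hw, k3HilbertForm_add_right, k3HilbertForm_add_right, k3HilbertForm_smul_right,
      k3HilbertForm_smul_right, hhh', hhz, hhzbar]
    ring
  have hh0 : h = 0 := by
    have hnd := qC_nondegenerate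
    refine hnd.1 h fun w => ?_
    rw [qC_apply]
    exact hrad w
  refine ⟨a, ?_⟩
  apply φ.injective
  rw [map_smul, LinearEquiv.apply_symm_apply, ← hu]
  have : u - a • z - b • star z = 0 := hh0
  rw [hb0, zero_smul, sub_zero, sub_eq_zero] at this
  exact this

end Summit.HodgeConjecture.HodgeConjecture.Theorems.MarkmanPartnerTransport.PartnerLattice

end
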